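import Mathlib
import Summits.ValiantsHypothesis.ValiantsHypothesis.Theorems.GrenetZeonHessianRankCodimTwoReduceModP

/-!
# Crux `GrenetZeon.TwoDimCoefficients` (stmt-ValiantsHypothesis-8062), stub `stub_dualUnipotent`:
# scaling-closure — QUASI-HOMOGENEOUS SQUAREFREE DESCENT `ℂ[z] → ℂ(z)[t]` (residual R9″ of memo SEVENTEENTH-HAND.md)

The 17th hand's 3/2 rung ✓ `cube_le_two_mul_sq_of_index_squarefree` / ✓ `cube_le_two_mul_sq_of_raySquarefree`
(`n³ ≤ 2m²` for index-`n` resp. hdeg unipotent dual representations of `per_n`) asks for squarefreeness of the RAY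
POLYNOMIAL `R(t) = c + Σ_k Q_k(z)·t^k` (`Q_k = [D_k]_{kn}` homogeneous of degree `k·n`) in `ℂ(z)[t]`.  This file proves
the generic algebra that removes the function field from the certificate (applied in `…ScalingShadowSquarefree`):

* `squarefree_aeval_scale` — the homothety `z ↦ a·z` (`a ≠ 0`) is a ring automorphism of `ℂ[z]`, so it preserves
  squarefreeness; `aeval_scale_eval_one_of_quasiHomogeneous` — it carries the SHADOW `R(1)` to `R(aⁿ)`.
* ★ `natDegree_eq_zero_of_sq_dvd_quasiHomogeneous` — `R ∈ ℂ[z][t]` with `t^j`-coefficient homogeneous of degree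
  `n·j` (`n ≥ 1`), constant coefficient `c ≠ 0`, shadow `R(1)` squarefree ⟹ every `S` with `S² ∣ R` is a constant
  (`S(μ)` is a unit for all `μ ≠ 0`; an infinite-roots argument makes the coefficients of `S` constants; the
  constant-term map `ℂ[z] → ℂ` sends `R` to `c`).
* ★★ `squarefree_map_fractionRing_of_quasiHomogeneous` — under the same hypotheses `R` is squarefree in `ℂ(z)[t]`
  (Gauss: `IsLocalization.integerNormalization`, `primPart`, `IsPrimitive.dvd_of_fraction_map_dvd_fraction_map`).
* `isQuasiHomogeneous_charpolyRev` — `det(1 − t·M)` has `t^j`-coefficient homogeneous of degree `n·j` when the entries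
  of `M` are homogeneous of degree `n` (so the index-`n` shadow `det(1 + t·c⁻¹P^top)` qualifies).

HONEST FRAMING: generic commutative algebra; nothing here is about the permanent; the stub `DualUnipotentBound`, both
cruxes (stmt-8062, stmt-24318) and `VP ≠ VNP` remain open.

References: folklore (Gauss's lemma over the UFD `ℂ[z]`).
-/

-- single-conjunct layout `Summits/ValiantsHypothesis/ValiantsHypothesis`: the duplicated namespace
-- component is mandated by the tree.
set_option linter.dupNamespace false
set_option autoImplicit false

noncomputable section

namespace Summit.ValiantsHypothesis.ValiantsHypothesis.Theorems.GrenetZeonTwoDimCoefficients.ScalingClosure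

open MvPolynomial Matrix
open Summit.ValiantsHypothesis.ValiantsHypothesis.Theorems.GrenetZeonHessianRankCodimTwo
  (aeval_smul_of_isHomogeneous)

section Scale

variable {σ : Type*}

/-- Homotheties `z ↦ a·z` compose multiplicatively. [folklore] -/
theorem aeval_scale_comp (a b : ℂ) :
    (MvPolynomial.aeval (R := ℂ) (fun i : σ => C a * X i)).comp
        (MvPolynomial.aeval (fun i : σ => C b * X i)) =
      MvPolynomial.aeval (fun i : σ => C (a * b) * X i) := by
  refine MvPolynomial.algHom_ext fun i => ?_
  simp only [AlgHom.comp_apply, MvPolynomial.aeval_X, map_mul, MvPolynomial.algHom_C,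
    MvPolynomial.algebraMap_eq]
  ring

/-- The trivial homothety is the identity. [folklore] -/
theorem aeval_scale_one :
    MvPolynomial.aeval (R := ℂ) (fun i : σ => C (1 : ℂ) * X i) = AlgHom.id ℂ (MvPolynomial σ ℂ) := by
  refine MvPolynomial.algHom_ext fun i => ?_
  simp

/-- A homogeneous polynomial of degree `d` is an eigenvector of the homothety: `p(a·z) = a^d·p(z)`. [folklore] -/
theorem aeval_scale_of_isHomogeneous' (a : ℂ) {p : MvPolynomial σ ℂ} {d : ℕ} (hp : p.IsHomogeneous d) :
    MvPolynomial.aeval (fun i : σ => C a * X i) p = C (a ^ d) * p := by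
  have h := aeval_smul_of_isHomogeneous hp (C a : MvPolynomial σ ℂ) X
  have hX : (C a : MvPolynomial σ ℂ) • (X : σ → MvPolynomial σ ℂ) = fun i => C a * X i := by
    funext i; simp [Pi.smul_apply, smul_eq_mul]
  rw [hX, MvPolynomial.aeval_X_left, AlgHom.id_apply, ← map_pow] at h
  exact h

/-- Squarefreeness is transported along a multiplicative equivalence. [folklore] -/
theorem squarefree_of_mulEquiv {M N : Type*} [Monoid M] [Monoid N] (e : M ≃* N) {x : M}
    (hx : Squarefree x) : Squarefree (e x) := by
  intro y hy
  have h' : e.symm y * e.symm y ∣ x := by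
    have := map_dvd e.symm hy
    simpa using this
  have hu := hx _ h'
  simpa using hu.map e

/-- The homothety `z ↦ a·z`, `a ≠ 0`, preserves squarefreeness (it is a ring automorphism). [folklore] -/
theorem squarefree_aeval_scale (a : ℂ) (ha : a ≠ 0) {p : MvPolynomial σ ℂ} (hp : Squarefree p) :
    Squarefree (MvPolynomial.aeval (fun i : σ => C a * X i) p) := by
  let e : MvPolynomial σ ℂ ≃ₐ[ℂ] MvPolynomial σ ℂ :=
    AlgEquiv.ofAlgHom (MvPolynomial.aeval (fun i : σ => C a * X i))
      (MvPolynomial.aeval (fun i : σ => C a⁻¹ * X i))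
      (by rw [aeval_scale_comp, mul_inv_cancel₀ ha, aeval_scale_one])
      (by rw [aeval_scale_comp, inv_mul_cancel₀ ha, aeval_scale_one])
  exact squarefree_of_mulEquiv e.toMulEquiv hp

end Scale

section Descent

variable {σ : Type*}

/-- Scaling the shadow: if the `t^j`-coefficient of `R ∈ ℂ[z][t]` is homogeneous of degree `n·j`, then
`R(1)(a·z) = R(aⁿ)(z)`. [folklore] -/
theorem aeval_scale_eval_one_of_quasiHomogeneous {n : ℕ} (R : Polynomial (MvPolynomial σ ℂ))
    (hR : ∀ j, (R.coeff j).IsHomogeneous (n * j)) (a : ℂ) :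
    MvPolynomial.aeval (fun i : σ => C a * X i) (R.eval 1) = R.eval (C (a ^ n)) := by
  rw [Polynomial.eval_eq_sum_range, Polynomial.eval_eq_sum_range, map_sum]
  refine Finset.sum_congr rfl fun j _ => ?_
  rw [one_pow, mul_one, aeval_scale_of_isHomogeneous' a (hR j), pow_mul, map_pow, mul_comm]

/-- For `R` quasi-homogeneous with squarefree shadow `R(1)`, every value `R(μ)`, `μ ≠ 0`, is squarefree. [folklore] -/
theorem squarefree_eval_C_of_quasiHomogeneous {n : ℕ} (hn : 1 ≤ n) (R : Polynomial (MvPolynomial σ ℂ))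
    (hR : ∀ j, (R.coeff j).IsHomogeneous (n * j)) (hsq : Squarefree (R.eval 1)) {μ : ℂ} (hμ : μ ≠ 0) :
    Squarefree (R.eval (C μ)) := by
  obtain ⟨a, ha⟩ := IsAlgClosed.exists_pow_nat_eq μ hn
  have ha0 : a ≠ 0 := by rintro rfl; simp [zero_pow (by omega : n ≠ 0)] at ha; exact hμ ha.symm
  rw [← ha, ← aeval_scale_eval_one_of_quasiHomogeneous R hR a]
  exact squarefree_aeval_scale a ha0 hsq

/-- ★ **Quasi-homogeneous squarefree descent, polynomial form.**  `R ∈ ℂ[z][t]` with `t^j`-coefficient homogeneous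
of degree `n·j` (`n ≥ 1`), constant coefficient `c ≠ 0` and squarefree shadow `R(1) ∈ ℂ[z]`: every `S` with `S² ∣ R`
is a constant. [folklore] -/
theorem natDegree_eq_zero_of_sq_dvd_quasiHomogeneous {n : ℕ} (hn : 1 ≤ n)
    (R S : Polynomial (MvPolynomial σ ℂ)) (c : ℂ) (hc : c ≠ 0)
    (hR : ∀ j, (R.coeff j).IsHomogeneous (n * j)) (hR0 : R.coeff 0 = C c)
    (hsq : Squarefree (R.eval 1)) (hS : S * S ∣ R) : S.natDegree = 0 := by
  classical
  -- Step 1: `S(μ)` is a unit, hence a constant, for every `μ ≠ 0`.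
  have hunit : ∀ μ : ℂ, μ ≠ 0 → ∃ r : ℂ, S.eval (C μ) = C r := by
    intro μ hμ
    have hdvd : S.eval (C μ) * S.eval (C μ) ∣ R.eval (C μ) := by
      rw [← Polynomial.eval_mul]; exact Polynomial.eval_dvd hS
    obtain ⟨r, -, hr⟩ := (MvPolynomial.isUnit_iff_eq_C_of_isReduced).mp
      ((squarefree_eval_C_of_quasiHomogeneous hn R hR hsq hμ) _ hdvd)
    exact ⟨r, hr⟩
  -- Step 2: all coefficients of all `S.coeff j` at non-zero monomials vanish.
  have hcoeff : ∀ (e : σ →₀ ℕ), e ≠ 0 → ∀ j, MvPolynomial.coeff e (S.coeff j) = 0 := by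
    intro e he j
    set q : Polynomial ℂ := ∑ j ∈ Finset.range (S.natDegree + 1),
      Polynomial.C (MvPolynomial.coeff e (S.coeff j)) * Polynomial.X ^ j with hq
    have hqeval : ∀ μ : ℂ, μ ≠ 0 → q.eval μ = 0 := by
      intro μ hμ
      obtain ⟨r, hr⟩ := hunit μ hμ
      have h1 : MvPolynomial.coeff e (S.eval (C μ)) = q.eval μ := by
        rw [Polynomial.eval_eq_sum_range, MvPolynomial.coeff_sum, hq, Polynomial.eval_finsetSum]
        refine Finset.sum_congr rfl fun j _ => ?_
        rw [← map_pow, mul_comm, MvPolynomial.coeff_C_mul, Polynomial.eval_mul, Polynomial.eval_C,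
          Polynomial.eval_pow, Polynomial.eval_X, mul_comm]
      rw [← h1, hr, MvPolynomial.coeff_C, if_neg (Ne.symm he)]
    have hq0 : q = 0 := by
      apply Polynomial.eq_zero_of_infinite_isRoot
      exact ((Set.finite_singleton (0 : ℂ)).infinite_compl).mono fun μ hμ => hqeval μ hμ
    have hqj : q.coeff j = MvPolynomial.coeff e (S.coeff j) := by
      rw [hq, Polynomial.finsetSum_coeff]
      simp only [Polynomial.coeff_C_mul_X_pow, Finset.sum_ite_eq, Finset.mem_range]
      split_ifs with hj
      · rfl
      · rw [Polynomial.coeff_eq_zero_of_natDegree_lt (by omega), MvPolynomial.coeff_zero]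
    rw [← hqj, hq0, Polynomial.coeff_zero]
  -- Step 3: hence every coefficient of `S` is a constant of `ℂ[z]`.
  have hS_C : ∀ j, S.coeff j = C (MvPolynomial.coeff 0 (S.coeff j)) := by
    intro j
    ext e
    rw [MvPolynomial.coeff_C]
    split_ifs with he
    · rw [← he]
    · exact hcoeff e (Ne.symm he) j
  -- Step 4: the constant-term map `ℂ[z] → ℂ` sends `R` to the unit `C c` and `S` to a polynomial of the same degree.
  set ψ : MvPolynomial σ ℂ →+* ℂ := MvPolynomial.constantCoeff with hψ
  have hRψ : R.map ψ = Polynomial.C c := by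
    ext j
    rw [Polynomial.coeff_map, Polynomial.coeff_C]
    split_ifs with hj
    · rw [hj, hR0, hψ, MvPolynomial.constantCoeff_C]
    · rw [hψ, MvPolynomial.constantCoeff_eq, (hR j).coeff_eq_zero]
      rw [map_zero]
      intro h0
      have : n * j ≠ 0 := Nat.mul_ne_zero (by omega) hj
      exact this h0.symm
  have hSψ_unit : IsUnit (S.map ψ) := by
    have hdvd : S.map ψ * S.map ψ ∣ Polynomial.C c := by
      rw [← Polynomial.map_mul, ← hRψ]; exact Polynomial.map_dvd ψ hS
    exact isUnit_of_mul_isUnit_left (isUnit_of_dvd_unit hdvd (Polynomial.isUnit_C.mpr (IsUnit.mk0 c hc)))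
  have hSback : (S.map ψ).map (MvPolynomial.C : ℂ →+* MvPolynomial σ ℂ) = S := by
    ext j : 1
    rw [Polynomial.coeff_map, Polynomial.coeff_map, hψ, MvPolynomial.constantCoeff_eq, ← hS_C j]
  rw [← hSback, Polynomial.natDegree_map_eq_of_injective (MvPolynomial.C_injective σ ℂ)]
  exact Polynomial.natDegree_eq_zero_of_isUnit hSψ_unit

/-- ★★ **Quasi-homogeneous squarefree descent** (residual R9″ of the 17th hand).  `R ∈ ℂ[z][t]` with
`t^j`-coefficient homogeneous of degree `n·j` (`n ≥ 1`), constant coefficient `c ≠ 0`, and SQUAREFREE SHADOW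
`R(1) ∈ ℂ[z]` is squarefree over the function field `ℂ(z)` (Gauss's lemma supplies the primitive descent). [folklore] -/
theorem squarefree_map_fractionRing_of_quasiHomogeneous {n : ℕ} (hn : 1 ≤ n)
    (R : Polynomial (MvPolynomial σ ℂ)) (c : ℂ) (hc : c ≠ 0)
    (hR : ∀ j, (R.coeff j).IsHomogeneous (n * j)) (hR0 : R.coeff 0 = C c)
    (hsq : Squarefree (R.eval 1)) :
    Squarefree (R.map (algebraMap (MvPolynomial σ ℂ) (FractionRing (MvPolynomial σ ℂ)))) := by
  classical
  set A := MvPolynomial σ ℂ with hA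
  set K := FractionRing (MvPolynomial σ ℂ) with hK
  have hinj : Function.Injective (algebraMap A K) := IsFractionRing.injective A K
  have hR_ne : R ≠ 0 := by
    intro h
    have := hR0
    rw [h, Polynomial.coeff_zero] at this
    exact hc (MvPolynomial.C_injective σ ℂ (by rw [map_zero]; exact this)).symm
  intro x hx
  have hx0 : x ≠ 0 := by
    rintro rfl
    rw [zero_mul, zero_dvd_iff, Polynomial.map_eq_zero_iff hinj] at hx
    exact hR_ne hx
  obtain ⟨b, hbM, hb⟩ := IsLocalization.integerNormalization_spec (nonZeroDivisors A) (S := K) x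
  set S₁ : Polynomial A := IsLocalization.integerNormalization (nonZeroDivisors A) x with hS₁
  have hb0 : (b : A) ≠ 0 := nonZeroDivisors.ne_zero hbM
  have hb0' : algebraMap A K b ≠ 0 := fun h => hb0 (hinj (by rw [h, map_zero]))
  letI : NormalizedGCDMonoid A := Nonempty.some inferInstance
  set S₀ : Polynomial A := S₁.primPart with hS₀
  have hS₁eq : S₁ = Polynomial.C S₁.content * S₀ := S₁.eq_C_content_mul_primPart
  -- `x` is a unit multiple of `S₀.map` in `K[t]`.
  have hS₁ne : S₁ ≠ 0 := by
    intro h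
    have : (b : A) • x = 0 := by rw [← hb, h, Polynomial.map_zero]
    exact (smul_ne_zero hb0 hx0) (by rwa [Algebra.smul_def, Polynomial.algebraMap_apply] at this ⊢)
  have hcont : algebraMap A K S₁.content ≠ 0 := fun h =>
    (mt Polynomial.content_eq_zero_iff.mp hS₁ne) (hinj (by rw [h, map_zero]))
  have hx_eq : x = Polynomial.C ((algebraMap A K b)⁻¹) * (Polynomial.C (algebraMap A K S₁.content) *
      S₀.map (algebraMap A K)) := by
    have h1 : S₁.map (algebraMap A K) = b • x := hb
    rw [hS₁eq, Polynomial.map_mul, Polynomial.map_C, Algebra.smul_def, Polynomial.algebraMap_apply] at h1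
    rw [h1, ← mul_assoc, ← Polynomial.C_mul, inv_mul_cancel₀ hb0', Polynomial.C_1, one_mul]
  have hxS₀ : S₀.map (algebraMap A K) ∣ x :=
    ⟨Polynomial.C ((algebraMap A K b)⁻¹ * algebraMap A K S₁.content), by rw [hx_eq, Polynomial.C_mul]; ring⟩
  have hdvdK : (S₀ * S₀).map (algebraMap A K) ∣ R.map (algebraMap A K) := by
    rw [Polynomial.map_mul]
    exact (mul_dvd_mul hxS₀ hxS₀).trans hx
  have hprim : (S₀ * S₀).IsPrimitive := (S₁.isPrimitive_primPart).mul S₁.isPrimitive_primPart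
  have hdvd : S₀ * S₀ ∣ R := hprim.dvd_of_fraction_map_dvd_fraction_map hdvdK
  have hdeg : S₀.natDegree = 0 := natDegree_eq_zero_of_sq_dvd_quasiHomogeneous hn R S₀ c hc hR hR0 hsq hdvd
  have hS₀ne : S₀ ≠ 0 := S₁.primPart_ne_zero
  have hS₀C : S₀ = Polynomial.C (S₀.coeff 0) := Polynomial.eq_C_of_natDegree_eq_zero hdeg
  have hs0 : S₀.coeff 0 ≠ 0 := by
    intro h; apply hS₀ne; rw [hS₀C, h, Polynomial.C_0]
  have hunitS₀ : IsUnit (S₀.map (algebraMap A K)) := by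
    rw [hS₀C, Polynomial.map_C]
    exact Polynomial.isUnit_C.mpr (IsUnit.mk0 _ fun h => hs0 (hinj (by rw [h, map_zero])))
  rw [hx_eq]
  exact (Polynomial.isUnit_C.mpr (IsUnit.mk0 _ (inv_ne_zero hb0'))).mul
    ((Polynomial.isUnit_C.mpr (IsUnit.mk0 _ hcont)).mul hunitS₀)

end Descent

section QuasiHomogeneous

variable {σ : Type*}

/-- Quasi-homogeneity (coefficient of `t^j` homogeneous of degree `n·j`) of `1`. [folklore] -/
theorem quasiHom_one (n : ℕ) : ∀ j, ((1 : Polynomial (MvPolynomial σ ℂ)).coeff j).IsHomogeneous (n * j) := by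
  intro j
  rw [Polynomial.coeff_one]
  split_ifs with hj
  · subst hj; rw [mul_zero]; exact isHomogeneous_one σ ℂ
  · exact isHomogeneous_zero σ ℂ _

/-- Quasi-homogeneity is stable under negation. [folklore] -/
theorem quasiHom_neg {n : ℕ} {p : Polynomial (MvPolynomial σ ℂ)} (hp : ∀ j, (p.coeff j).IsHomogeneous (n * j)) :
    ∀ j, ((-p).coeff j).IsHomogeneous (n * j) := fun j => by
  rw [Polynomial.coeff_neg]; exact (hp j).neg

/-- Quasi-homogeneity is stable under products. [folklore] -/
theorem quasiHom_mul {n : ℕ} {p q : Polynomial (MvPolynomial σ ℂ)}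
    (hp : ∀ j, (p.coeff j).IsHomogeneous (n * j)) (hq : ∀ j, (q.coeff j).IsHomogeneous (n * j)) :
    ∀ j, ((p * q).coeff j).IsHomogeneous (n * j) := by
  intro j
  rw [Polynomial.coeff_mul]
  refine IsHomogeneous.sum _ _ _ fun x hx => ?_
  have hx' : x.1 + x.2 = j := Finset.HasAntidiagonal.mem_antidiagonal.mp hx
  have h := (hp x.1).mul (hq x.2)
  rwa [← mul_add, hx'] at h

/-- Quasi-homogeneity is stable under finite products. [folklore] -/
theorem quasiHom_prod {ι : Type*} {n : ℕ} (s : Finset ι) (f : ι → Polynomial (MvPolynomial σ ℂ))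
    (hf : ∀ i ∈ s, ∀ j, ((f i).coeff j).IsHomogeneous (n * j)) :
    ∀ j, ((∏ i ∈ s, f i).coeff j).IsHomogeneous (n * j) := by
  classical
  induction s using Finset.induction_on with
  | empty => simpa using quasiHom_one (σ := σ) n
  | insert a s ha ih =>
    rw [Finset.prod_insert ha]
    exact quasiHom_mul (hf a (Finset.mem_insert_self a s))
      (ih fun i hi => hf i (Finset.mem_insert_of_mem hi))

/-- Quasi-homogeneity is stable under finite sums. [folklore] -/
theorem quasiHom_sum {ι : Type*} {n : ℕ} (s : Finset ι) (f : ι → Polynomial (MvPolynomial σ ℂ))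
    (hf : ∀ i ∈ s, ∀ j, ((f i).coeff j).IsHomogeneous (n * j)) :
    ∀ j, ((∑ i ∈ s, f i).coeff j).IsHomogeneous (n * j) := by
  intro j
  rw [Polynomial.finsetSum_coeff]
  exact IsHomogeneous.sum _ _ _ fun i hi => hf i hi j

/-- The entries of `1 − t·M` are quasi-homogeneous when the entries of `M` are homogeneous of degree `n`. [folklore] -/
theorem quasiHom_one_sub_X_smul_entry {ι : Type*} [DecidableEq ι] {n : ℕ} (M : Matrix ι ι (MvPolynomial σ ℂ))
    (hM : ∀ i j, (M i j).IsHomogeneous n) (a b : ι) :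
    ∀ j, (Polynomial.coeff (((1 : Matrix ι ι (Polynomial (MvPolynomial σ ℂ))) -
      (Polynomial.X : Polynomial (MvPolynomial σ ℂ)) • M.map Polynomial.C) a b) j).IsHomogeneous (n * j) := by
  intro j
  have hentry : ((1 : Matrix ι ι (Polynomial (MvPolynomial σ ℂ))) -
      (Polynomial.X : Polynomial (MvPolynomial σ ℂ)) • M.map Polynomial.C) a b =
      Polynomial.C (if a = b then 1 else 0) - Polynomial.C (M a b) * Polynomial.X := by
    rw [Matrix.sub_apply, Matrix.smul_apply, Matrix.map_apply, Matrix.one_apply, smul_eq_mul, mul_comm]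
    split_ifs <;> simp
  rw [hentry, Polynomial.coeff_sub, Polynomial.coeff_C, Polynomial.coeff_C_mul_X]
  rcases j with _ | _ | j
  · rw [if_pos rfl, if_neg Nat.zero_ne_one, sub_zero, mul_zero]
    split_ifs
    · exact isHomogeneous_one σ ℂ
    · exact isHomogeneous_zero σ ℂ _
  · rw [if_neg Nat.one_ne_zero, zero_add, if_pos rfl, zero_sub, mul_one]
    exact (hM a b).neg
  · rw [if_neg (by omega), if_neg (by omega), sub_zero]
    exact isHomogeneous_zero σ ℂ _

/-- **`det(1 − t·M)` is quasi-homogeneous**: its `t^j`-coefficient (`= (−1)^j σ_j(M)`) is homogeneous of degree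
`n·j` when the entries of `M` are homogeneous of degree `n`. [folklore] -/
theorem isQuasiHomogeneous_charpolyRev {ι : Type*} [Fintype ι] [DecidableEq ι] {n : ℕ}
    (M : Matrix ι ι (MvPolynomial σ ℂ)) (hM : ∀ i j, (M i j).IsHomogeneous n) :
    ∀ j, (M.charpolyRev.coeff j).IsHomogeneous (n * j) := by
  rw [Matrix.charpolyRev, Matrix.det_apply']
  refine quasiHom_sum _ _ fun τ _ => ?_
  have hprod := quasiHom_prod (n := n) Finset.univ
    (fun i => ((1 : Matrix ι ι (Polynomial (MvPolynomial σ ℂ))) -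
      (Polynomial.X : Polynomial (MvPolynomial σ ℂ)) • M.map Polynomial.C) (τ i) i)
    fun i _ => quasiHom_one_sub_X_smul_entry M hM (τ i) i
  rcases Int.units_eq_one_or (Equiv.Perm.sign τ) with h | h
  · rw [h]; simpa using hprod
  · rw [h]
    simpa using quasiHom_neg hprod

end QuasiHomogeneous





end Summit.ValiantsHypothesis.ValiantsHypothesis.Theorems.GrenetZeonTwoDimCoefficients.ScalingClosure

end
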